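import Literature.MathematicalPhysics.QuantumLattice.GrassmannLaplacianTreeExpansion
import Literature.MathematicalPhysics.QuantumLattice.GrassmannLaplacianGramBound
import Literature.MathematicalPhysics.QuantumLattice.GrassmannDeletionExpansion
import Literature.MathematicalPhysics.QuantumLattice.FermionicTreeExpansionBounds
import Literature.RingTheory.MvPolynomial.FormalCubeIntegralLinear
import HarnessLib

/-!
# The Gram bound for the kernels of one tree factor of the Laplacian-host tree expansion

Topic `Literature/MathematicalPhysics/QuantumLattice`.  In the operator form of the Battle–Brydges–Federbush
expansion (`GrassmannLaplacianTreeExpansion.lean`) the truncated expectation of even cluster elements is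
`𝓔ᵀ_C(M_v) = Σ_s treeFactor s (∏ M_v)`, `treeFactor s = ∫_{[0,1]^ι} w_s(t) (∏_{ℓ ∈ lines s} Δ_{C|ℓ}) e^{Δ_{σ_s(t)∘C}} dt`.
This file bounds the KERNELS of one tree factor applied to one monomial `ψ(Z₀)⋯ψ(Z_{N-1})` for a CHARGED
covariance whose two-point function is in GRAM form on the mixed pairs, `A(X̄,Y) = ⟪f X̄, g Y⟫`, `‖f‖, ‖g‖ ≤ κ`
(**`norm_kernel_treeFactor_genProd_le`**):

`‖kernel_r (treeFactor s · ψ(Z)) (W)‖ ≤ (r!)⁻¹ (Σ_{patterns π} weight(Z, π) κ^{N − (r + 2k)}) · ∫ w_s`,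

the pattern sum of `GrassmannDeletionExpansion.lean` over the deletion patterns of the `r` kernel derivatives
`∂_{W_i}` and the `k` tree-line Laplacians `Δ_{C|ℓ}` (`scriptOps`), with weights `∏ δ_{Z_p, W_i} ∏ ½|C|ℓ(Z_q, Z_p)|`.
The steps: the kernel of the formal cube integral is the formal integral of the kernels at the parameters
(`FormalCubeIntegralLinear.coeffMap`, `kernel_treeFactor_eq`); at a real `t` the tree factor is
`(∏ Δ_{C|ℓ}) e^{Δ_{C_{s,t}}}` with the interpolated covariance `scriptCov` (`coe_aeval_treeCore`); the derivatives
of the kernel commute with the Laplacians and the convolution, so the kernel is the Gaussian expectation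
`∫ dμ_{C_{s,t}}` of the deleted monomial (`kernel_prod_gaussConv_eq`); `C_{s,t}` is charged and in Gram form with
the tensor vectors `u_{cl X} ⊗ f X` of the Gram vectors of the interpolation factors (`Script.exists_unit_gram`,
`FermionicTree.tens`; `norm_gaussExpect_scriptCov_genProd_le`) — hence the Gram–Hadamard bound `κ^{deg}` of
`GrassmannLaplacianGramBound.lean` for the loop lines and the deletion expansion of `GrassmannDeletionExpansion.lean`
for the tree lines and external legs (Benfatto–Giuliani–Mastropietro 2006, (2.66)/(2.80); Gawȩdzki–Kupiainen 1985;
Lesniewski 1987).  Everything is proved; no named fact.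

## Sources

G. Benfatto, A. Giuliani, V. Mastropietro, Ann. Henri Poincaré 7 (2006) 809–898, (2.66), (2.77), (2.80)
(`BenfattoGiulianiMastropietro2006`); V. Mastropietro, *Non-Perturbative Renormalization* (2008), §2.9 Lemma 2.2
(`Mastropietro2008`); J. Feldman, H. Knörrer, E. Trubowitz, Commun. Math. Phys. 247 (2004) 195–242, §II and App. B
(`FeldmanKnorrerTrubowitz2004`).
-/

noncomputable section

open MvPolynomial Finsupp Matrix Finset Literature.RingTheory.MvPolynomial
open Literature.Probability.LatticeModels Literature.Probability.LatticeModels.BattleFederbush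
open Literature.MeasureTheory.Integral
open scoped InnerProductSpace

namespace Literature.MathematicalPhysics.QuantumLattice

open GrassmannAlgebra

/-! ### Commutation of derivatives, Laplacians and convolutions -/

section Commute

variable (R : Type*) [CommRing R] [Algebra ℚ R] {Γ : Type*} [Fintype Γ]

/-- Derivatives commute with Laplacians. [folklore] -/
theorem commute_grassmannDeriv_grassmannLaplacian (X : Γ) (C : Matrix Γ Γ R) :
    Commute (grassmannDeriv R X) (grassmannLaplacian R C) :=
  LinearMap.ext fun a => grassmannDeriv_grassmannLaplacian R C X a

/-- Derivatives commute with Gaussian convolutions. [folklore] -/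
theorem commute_grassmannDeriv_gaussConv (X : Γ) (C : Matrix Γ Γ R) : Commute (grassmannDeriv R X) (gaussConv R C) :=
  LinearMap.ext fun a => grassmannDeriv_gaussConv R C X a

omit [Fintype Γ] in
/-- A nilpotent exponential commutes with what its exponent commutes with. [folklore] -/
theorem commute_exp_of_commute {T S : Module.End R (GrassmannAlgebra R Γ)} (hT : IsNilpotent T)
    (h : Commute T S) : Commute (IsNilpotent.exp T) S := by
  obtain ⟨k, hk⟩ := hT
  rw [IsNilpotent.exp_eq_sum hk]
  exact Commute.sum_left _ _ _ fun i _ => (h.pow_left i).smul_left _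

/-- Gaussian convolutions commute with Laplacians. [folklore] -/
theorem commute_gaussConv_grassmannLaplacian (C C' : Matrix Γ Γ R) : Commute (gaussConv R C) (grassmannLaplacian R C') :=
  commute_exp_of_commute R (isNilpotent_grassmannLaplacian R C) (commute_grassmannLaplacian R C C')

omit [Algebra ℚ R] [Fintype Γ] in
/-- Iterated derivatives commute with whatever every derivative commutes with. [folklore] -/
theorem commute_iterDeriv_of_forall {T : Module.End R (GrassmannAlgebra R Γ)} (h : ∀ X : Γ, Commute (grassmannDeriv R X) T)
    {m : ℕ} (W : Fin m → Γ) : Commute (iterDeriv R W) T := by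
  change Commute ((List.ofFn fun i => grassmannDeriv R (W i)).reverse).prod T
  exact Commute.list_prod_left _ _ fun D hD => by
    obtain ⟨i, rfl⟩ := List.mem_ofFn.1 (List.mem_reverse.1 hD)
    exact h (W i)

end Commute

/-! ### The interpolated covariance of a script and the evaluated tree-factor operator -/

section ScriptCov

variable {𝕜 : Type*} [RCLike 𝕜] {Γ : Type*} [Fintype Γ] {ι : Type*} [Fintype ι] [DecidableEq ι]
variable (C : Matrix Γ Γ 𝕜) (cl : Γ → ι) {v : ι} {k : ℕ}

/-- The **interpolated covariance** of the script `s` at the real parameters `t`: the pairs inside the point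
set of `s` scaled by their live interpolation factor `σ_s(ℓ)(t)`, all other pairs switched off
(Benfatto–Giuliani–Mastropietro 2006, (2.67): `t_{i,i'} g`). [folklore] -/
def scriptCov (s : Script v k) (t : ι → ℝ) : Matrix Γ Γ 𝕜 :=
  scaleByType C cl fun ℓ => if insideB (univ.image s.y) ℓ = true then ((eval t (s.livePt ℝ ℓ) : ℝ) : 𝕜) else 0

omit [Fintype ι] in
/-- The live interpolation point over `𝕜` is the `𝕜`-version of the real one. [folklore] -/
theorem livePt_eq_map (s : Script v k) (ℓ : Sym2 ι) : s.livePt 𝕜 ℓ = MvPolynomial.map (algebraMap ℝ 𝕜) (s.livePt ℝ ℓ) := by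
  simp [Script.livePt, map_monomial]

omit [Fintype ι] in
/-- Evaluating the live interpolation point of the polynomial ring over the algebra of pair Laplacians at
`𝕜`-points. [folklore] -/
theorem aeval_livePt (s : Script v k) (ℓ : Sym2 ι) (t : ι → ℝ) :
    aeval (fun i => algebraMap 𝕜 (laplacianAlgebra 𝕜 C cl) ((t i : ℝ) : 𝕜)) (s.livePt (laplacianAlgebra 𝕜 C cl) ℓ) =
      algebraMap 𝕜 (laplacianAlgebra 𝕜 C cl) ((eval t (s.livePt ℝ ℓ) : ℝ) : 𝕜) := by
  rw [Script.livePt, Script.livePt, aeval_monomial, map_one, one_mul, eval_monomial, one_mul, Finsupp.prod, Finsupp.prod,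
    RCLike.ofReal_prod, map_prod]
  simp only [map_pow]

/-- **The tree-factor polynomial evaluated at real parameters is `(∏_{ℓ ∈ lines} Δ_{C|ℓ}) e^{Δ_{C_{s,t}}}`.**
[folklore] -/
theorem coe_aeval_treeCore (s : Script v k) (t : ι → ℝ) :
    ((aeval (fun i => algebraMap 𝕜 (laplacianAlgebra 𝕜 C cl) ((t i : ℝ) : 𝕜))
        (MvPolynomial.C ((s.lines.map (pairLap 𝕜 C cl)).prod) * IsNilpotent.exp (Script.innerForm (pairLap 𝕜 C cl) s)) :
          laplacianAlgebra 𝕜 C cl) : Module.End 𝕜 (GrassmannAlgebra 𝕜 Γ)) =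
      (s.lines.map (pairLaplacian 𝕜 C cl)).prod * gaussConv 𝕜 (scriptCov C cl s t) := by
  set φ : ι → laplacianAlgebra 𝕜 C cl := fun i => algebraMap 𝕜 (laplacianAlgebra 𝕜 C cl) ((t i : ℝ) : 𝕜) with hφ
  have hnil := Script.isNilpotent_innerForm (isNilpotent_pairLap 𝕜 C cl) s
  -- the evaluated inner form is `Σ_{inside ℓ} σ_ℓ(t) Δ_{C|ℓ}`
  have hinner : aeval φ (Script.innerForm (pairLap 𝕜 C cl) s) =
      ∑ ℓ ∈ univ.filter (fun ℓ => insideB (univ.image s.y) ℓ = true), ((eval t (s.livePt ℝ ℓ) : ℝ) : 𝕜) • pairLap 𝕜 C cl ℓ := by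
    rw [Script.innerForm, map_sum]
    refine sum_congr rfl fun ℓ _ => ?_
    rw [map_mul, aeval_C, Algebra.algebraMap_self, RingHom.id_apply, aeval_livePt, ← Algebra.smul_def]
  have hcoe : (((∑ ℓ ∈ univ.filter (fun ℓ => insideB (univ.image s.y) ℓ = true),
      ((eval t (s.livePt ℝ ℓ) : ℝ) : 𝕜) • pairLap 𝕜 C cl ℓ : laplacianAlgebra 𝕜 C cl)) : Module.End 𝕜 (GrassmannAlgebra 𝕜 Γ)) =
      grassmannLaplacian 𝕜 (scriptCov C cl s t) := by
    rw [scriptCov, grassmannLaplacian_scaleByType, AddSubmonoidClass.coe_finsetSum, sum_filter]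
    refine sum_congr rfl fun ℓ _ => ?_
    split_ifs
    · rw [Subalgebra.coe_smul, coe_pairLap]
    · rw [zero_smul]
  rw [map_mul, aeval_C, Algebra.algebraMap_self, RingHom.id_apply, hnil.map_exp (aeval φ), MulMemClass.coe_mul,
    coe_exp 𝕜 C cl (hnil.map (aeval φ)), hinner, hcoe, ← gaussConv_def, SubmonoidClass.coe_list_prod, List.map_map]
  rfl

omit [Fintype Γ] [Fintype ι] [DecidableEq ι] in
/-- The two-point function of a covariance scaled by pair variables. [folklore] -/
theorem contr_scaleByType (p : Sym2 ι → 𝕜) (X Y : Γ) :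
    contr 𝕜 (scaleByType C cl p) X Y = p s(cl X, cl Y) * contr 𝕜 C X Y := by
  rw [contr_apply, contr_apply, scaleByType_apply, scaleByType_apply, Sym2.eq_swap, mul_sub, mul_sub]
  ring

variable [DecidableEq Γ]

omit [Fintype ι] in
/-- **The interpolated covariance is charged and in Gram form, uniformly on the cube**: for real parameters
`t ∈ [0,1]^ι` and a valid script, the Gaussian expectation of EVERY monomial satisfies the Gram–Hadamard bound
`‖∫ dμ_{C_{s,t}} ψ(Z₁)⋯ψ(Z_N)‖ ≤ κ^N` (Benfatto–Giuliani–Mastropietro 2006, (2.80) with the unit vectors of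
`Script.exists_unit_gram`). [cite: BenfattoGiulianiMastropietro2006, (2.80)] -/
theorem norm_gaussExpect_scriptCov_genProd_le {E : Type*} [NormedAddCommGroup E] [InnerProductSpace 𝕜 E]
    (q : Γ → Bool) (hC : ∀ X Y, q X = q Y → C X Y = 0) (f g : Γ → E) {κ : ℝ} (hκ : 0 ≤ κ)
    (hf : ∀ X, q X = true → ‖f X‖ ≤ κ) (hg : ∀ Y, q Y = false → ‖g Y‖ ≤ κ)
    (hG : ∀ X Y, q X = true → q Y = false → contr 𝕜 C X Y = ⟪f X, g Y⟫_𝕜)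
    (s : Script v k) (hs : s.Valid) {t : ι → ℝ} (ht : t ∈ unitCube ι) {N : ℕ} (Z : Fin N → Γ) :
    ‖gaussExpect 𝕜 (scriptCov C cl s t) (genProd 𝕜 Z)‖ ≤ κ ^ N := by
  classical
  obtain ⟨u, hu1, hu⟩ := Script.exists_unit_gram s hs t fun x => (mem_unitCube.1 ht) x
  -- the Gram vectors of the clusters: `u_i` at the point `y_i` of the script, `0` elsewhere
  set U : ι → EuclideanSpace ℝ (Fin (k + 1)) := fun a =>
    if h : ∃ i, s.y i = a then u (Classical.choose h) else 0 with hU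
  have hUy : ∀ i, U (s.y i) = u i := by
    intro i
    have h : ∃ j, s.y j = s.y i := ⟨i, rfl⟩
    rw [hU]; dsimp only; rw [dif_pos h, Script.y_injective s hs (Classical.choose_spec h)]
  have hUnorm : ∀ a, ‖U a‖ ≤ 1 := by
    intro a
    rw [hU]; dsimp only
    split_ifs with h
    · exact (hu1 _).le
    · rw [norm_zero]; exact zero_le_one
  -- the interpolation factor of every pair of clusters is the inner product of their Gram vectors
  have hp : ∀ a b : ι, (if insideB (univ.image s.y) s(a, b) = true then ((eval t (s.livePt ℝ s(a, b)) : ℝ) : 𝕜) else 0) =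
      ((⟪U a, U b⟫_ℝ : ℝ) : 𝕜) := by
    intro a b
    split_ifs with h
    · obtain ⟨ha, hb⟩ : a ∈ univ.image s.y ∧ b ∈ univ.image s.y := by
        have h' := (insideB_eq_true_iff _ _).1 h
        exact ⟨h' a (Sym2.mem_mk_left _ _), h' b (Sym2.mem_mk_right _ _)⟩
      obtain ⟨i, -, rfl⟩ := mem_image.1 ha
      obtain ⟨j, -, rfl⟩ := mem_image.1 hb
      rw [← Script.decPt_mk_of_mem_of_mem s ha hb, hu i j, hUy, hUy]
    · have h' : ¬ (a ∈ univ.image s.y ∧ b ∈ univ.image s.y) := fun hab =>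
        h ((insideB_eq_true_iff _ _).2 fun w hw => by rcases Sym2.mem_iff.1 hw with rfl | rfl; exacts [hab.1, hab.2])
      rcases not_and_or.1 h' with ha | hb
      · have hUa : U a = 0 := by rw [hU]; dsimp only; rw [dif_neg]; rintro ⟨i, rfl⟩; exact ha (mem_image_of_mem _ (mem_univ _))
        rw [hUa, inner_zero_left, RCLike.ofReal_zero]
      · have hUb : U b = 0 := by rw [hU]; dsimp only; rw [dif_neg]; rintro ⟨i, rfl⟩; exact hb (mem_image_of_mem _ (mem_univ _))
        rw [hUb, inner_zero_right, RCLike.ofReal_zero]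
  refine norm_gaussExpect_genProd_le q (scriptCov C cl s t) (fun X Y hXY => ?_)
    (fun X => FermionicTree.tens 𝕜 (U (cl X)) (f X)) (fun Y => FermionicTree.tens 𝕜 (U (cl Y)) (g Y)) hκ
    (fun X hX => ?_) (fun Y hY => ?_) (fun X Y hX hY => ?_) Z
  · rw [scriptCov, scaleByType_apply, hC X Y hXY, mul_zero]
  · rw [FermionicTree.norm_tens]
    exact (mul_le_mul (hUnorm _) (hf X hX) (norm_nonneg _) zero_le_one).trans (by rw [one_mul])
  · rw [FermionicTree.norm_tens]
    exact (mul_le_mul (hUnorm _) (hg Y hY) (norm_nonneg _) zero_le_one).trans (by rw [one_mul])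
  · rw [scriptCov, contr_scaleByType, hp, hG X Y hX hY, FermionicTree.inner_tens]

end ScriptCov

/-! ### The kernel of one tree factor on one monomial -/

section KernelBound

variable {𝕜 : Type*} [RCLike 𝕜] {Γ : Type*} [Fintype Γ] [DecidableEq Γ] {ι : Type*} [Fintype ι] [DecidableEq ι]
variable (C : Matrix Γ Γ 𝕜) (cl : Γ → ι) {v : ι} {k : ℕ}

/-- The **kernel functional** on the algebra of pair Laplacians: `T ↦ kernel (T x) r W`. [folklore] -/
def kernelOpLM (x : GrassmannAlgebra 𝕜 Γ) (r : ℕ) (W : Fin r → Γ) : laplacianAlgebra 𝕜 C cl →ₗ[𝕜] 𝕜 :=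
  ((r.factorial : ℚ)⁻¹ • (1 : 𝕜)) • ((constPart 𝕜).toLinearMap ∘ₗ iterDeriv 𝕜 W ∘ₗ applyOp 𝕜 C cl x)

omit [DecidableEq Γ] [Fintype ι] in
/-- Unfolding `kernelOpLM`. [folklore] -/
theorem kernelOpLM_apply (x : GrassmannAlgebra 𝕜 Γ) (r : ℕ) (W : Fin r → Γ) (T : laplacianAlgebra 𝕜 C cl) :
    kernelOpLM C cl x r W T = kernel 𝕜 ((T : Module.End 𝕜 (GrassmannAlgebra 𝕜 Γ)) x) r W := by
  rw [kernelOpLM, kernel_def, LinearMap.smul_apply, smul_eq_mul]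
  rfl

/-- The **deletion operations of a script and an output slot**: the `r` kernel derivatives `∂_{W_0}, …` first,
then the Laplacians `Δ_{C|ℓ}` of the tree lines, last line first. [folklore] -/
def scriptOps {r : ℕ} (W : Fin r → Γ) (s : Script v k) : List (DelOp Γ 𝕜) :=
  (List.ofFn W).map DelOp.ext ++ s.lines.reverse.map fun ℓ => DelOp.lap (typeRestrict C cl ℓ)

omit [Fintype Γ] [DecidableEq Γ] [Fintype ι] in
/-- The operations of a script delete `r + 2k` fields. [folklore] -/
theorem totalCost_scriptOps {r : ℕ} (W : Fin r → Γ) (s : Script v k) : totalCost (scriptOps C cl W s) = r + 2 * k := by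
  rw [scriptOps, totalCost, List.map_append, List.sum_append, List.map_map, List.map_map]
  have h1 : ((List.ofFn W).map (DelOp.cost ∘ DelOp.ext (𝕜 := 𝕜))).sum = r := by
    rw [show (DelOp.cost ∘ DelOp.ext (𝕜 := 𝕜) : Γ → ℕ) = fun _ => 1 from rfl, List.map_const', List.sum_replicate,
      List.length_ofFn, smul_eq_mul, mul_one]
  have h2 : (s.lines.reverse.map (DelOp.cost ∘ fun ℓ => DelOp.lap (typeRestrict C cl ℓ) : Sym2 ι → ℕ)).sum = 2 * k := by
    rw [show (DelOp.cost ∘ fun ℓ => DelOp.lap (typeRestrict C cl ℓ) : Sym2 ι → ℕ) = fun _ => 2 from rfl, List.map_const',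
      List.sum_replicate, List.length_reverse, Script.length_lines, smul_eq_mul, mul_comm]
  rw [h1, h2]

omit [DecidableEq Γ] [Fintype ι] in
/-- The operator of the operations of a script: the product of the line Laplacians times the iterated
derivative. [folklore] -/
theorem applyOps_scriptOps {r : ℕ} (W : Fin r → Γ) (s : Script v k) :
    applyOps (scriptOps C cl W s) = (s.lines.map (pairLaplacian 𝕜 C cl)).prod * iterDeriv 𝕜 W := by
  have hrev : ∀ L : List (DelOp Γ 𝕜), applyOps L = (L.map DelOp.toEnd).reverse.prod := by
    intro L
    induction L with
    | nil => rfl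
    | cons o L ih => rw [applyOps, ih, List.map_cons, List.reverse_cons, List.prod_append, List.prod_singleton]
  rw [scriptOps, applyOps_append, applyOps_map_ext, hrev, List.map_map, List.map_reverse, List.reverse_reverse]
  rfl

omit [DecidableEq Γ] [Fintype ι] in
/-- **Derivatives past the tree factor**: the kernel of `(∏ Δ_{C|ℓ}) e^{Δ_{C'}} x` is `(r!)⁻¹` times the Gaussian
expectation `∫ dμ_{C'}` of `(∏ Δ_{C|ℓ}) ∂_W x` (derivatives commute with Laplacians and convolutions, convolutions
with Laplacians). [folklore] -/
theorem kernel_prod_gaussConv_eq (s : Script v k) (C' : Matrix Γ Γ 𝕜) (x : GrassmannAlgebra 𝕜 Γ) {r : ℕ} (W : Fin r → Γ) :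
    kernel 𝕜 (((s.lines.map (pairLaplacian 𝕜 C cl)).prod * gaussConv 𝕜 C') x) r W =
      ((r.factorial : ℚ)⁻¹ • (1 : 𝕜)) *
        gaussExpect 𝕜 C' ((s.lines.map (pairLaplacian 𝕜 C cl)).prod (iterDeriv 𝕜 W x)) := by
  set P := (s.lines.map (pairLaplacian 𝕜 C cl)).prod with hP
  have hIP : Commute (iterDeriv 𝕜 W) P := Commute.list_prod_right _ _ fun D hD => by
    obtain ⟨ℓ, -, rfl⟩ := List.mem_map.1 hD
    exact commute_iterDeriv_of_forall 𝕜 (fun X => commute_grassmannDeriv_grassmannLaplacian 𝕜 X _) W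
  have hIG : Commute (iterDeriv 𝕜 W) (gaussConv 𝕜 C') :=
    commute_iterDeriv_of_forall 𝕜 (fun X => commute_grassmannDeriv_gaussConv 𝕜 X C') W
  have hGP : Commute (gaussConv 𝕜 C') P := Commute.list_prod_right _ _ fun D hD => by
    obtain ⟨ℓ, -, rfl⟩ := List.mem_map.1 hD
    exact commute_gaussConv_grassmannLaplacian 𝕜 C' _
  have key : iterDeriv 𝕜 W * (P * gaussConv 𝕜 C') = gaussConv 𝕜 C' * P * iterDeriv 𝕜 W := by
    rw [← mul_assoc, hIP.eq, mul_assoc, hIG.eq, ← mul_assoc, ← hGP.eq]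
  rw [kernel_def, gaussExpect_apply]
  congr 2
  calc iterDeriv 𝕜 W ((P * gaussConv 𝕜 C') x) = (iterDeriv 𝕜 W * (P * gaussConv 𝕜 C')) x := rfl
    _ = (gaussConv 𝕜 C' * P * iterDeriv 𝕜 W) x := by rw [key]
    _ = gaussConv 𝕜 C' (P (iterDeriv 𝕜 W x)) := rfl

/-- The norm of the kernel normalisation `(r!)⁻¹`. [folklore] -/
theorem norm_inv_factorial_smul_one (r : ℕ) : ‖((r.factorial : ℚ)⁻¹ • (1 : 𝕜))‖ = ((r.factorial : ℝ))⁻¹ := by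
  rw [Rat.smul_one_eq_cast, Rat.cast_inv, Rat.cast_natCast, norm_inv, RCLike.norm_natCast]

/-- **The Gram bound for the kernels of one tree factor on one monomial** (Benfatto–Giuliani–Mastropietro 2006,
(2.66) with (2.80)): for a charged covariance in Gram form on the mixed pairs (`‖f‖, ‖g‖ ≤ κ`), a valid script `s`
with `k` lines, a monomial `ψ(Z₀)⋯ψ(Z_{N-1})` and an output slot of `r` labels `W`,
`‖kernel_r (treeFactor s ψ(Z)) (W)‖ ≤ (r!)⁻¹ (Σ_{patterns π} weight(Z, π) κ^{N − (r + 2k)}) ∫ w_s`.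
[cite: BenfattoGiulianiMastropietro2006, (2.66) and (2.80)] -/
theorem norm_kernel_treeFactor_genProd_le {E : Type*} [NormedAddCommGroup E] [InnerProductSpace 𝕜 E]
    (q : Γ → Bool) (hC : ∀ X Y, q X = q Y → C X Y = 0) (f g : Γ → E) {κ : ℝ} (hκ : 0 ≤ κ)
    (hf : ∀ X, q X = true → ‖f X‖ ≤ κ) (hg : ∀ Y, q Y = false → ‖g Y‖ ≤ κ)
    (hG : ∀ X Y, q X = true → q Y = false → contr 𝕜 C X Y = ⟪f X, g Y⟫_𝕜)
    (s : Script v k) (hs : s.Valid) {N : ℕ} (Z : Fin N → Γ) {r : ℕ} (W : Fin r → Γ) :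
    ‖kernel 𝕜 (((Script.treeFactor (pairLap 𝕜 C cl) s : laplacianAlgebra 𝕜 C cl) : Module.End 𝕜 (GrassmannAlgebra 𝕜 Γ))
        (genProd 𝕜 Z)) r W‖ ≤
      (((r.factorial : ℝ))⁻¹ * ∑ π ∈ patSet (scriptOps C cl W s) univ,
          patWeight Z (scriptOps C cl W s) π * κ ^ (N - (r + 2 * k))) * cubeIntegral ι ℝ (s.weight ℝ) := by
  set θ := kernelOpLM C cl (genProd 𝕜 Z) r W with hθ
  set Q : MvPolynomial ι (laplacianAlgebra 𝕜 C cl) :=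
    MvPolynomial.C ((s.lines.map (pairLap 𝕜 C cl)).prod) * IsNilpotent.exp (Script.innerForm (pairLap 𝕜 C cl) s) with hQ
  -- the kernel of the formal integral is the formal integral of the kernels
  have h1 : kernel 𝕜 (((Script.treeFactor (pairLap 𝕜 C cl) s : laplacianAlgebra 𝕜 C cl) :
      Module.End 𝕜 (GrassmannAlgebra 𝕜 Γ)) (genProd 𝕜 Z)) r W =
      cubeIntegral ι 𝕜 (MvPolynomial.map (algebraMap ℝ 𝕜) (s.weight ℝ) * coeffMap θ Q) := by
    rw [← kernelOpLM_apply, Script.treeFactor, Script.treeFactorPoly, mul_assoc, ← cubeIntegral_coeffMap, Script.weight,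
      coeffMap_monomial_one_mul, show (monomial s.wExp (1 : 𝕜)) = s.weight 𝕜 from rfl, FermionicTree.weight_eq_map]
  -- at every real parameter the kernel is a Gaussian expectation of the deleted monomial, Gram-bounded
  have h2 : ∀ t ∈ unitCube ι, ‖eval (fun i => ((t i : ℝ) : 𝕜)) (coeffMap θ Q)‖ ≤
      ((r.factorial : ℝ))⁻¹ * ∑ π ∈ patSet (scriptOps C cl W s) univ, patWeight Z (scriptOps C cl W s) π * κ ^ (N - (r + 2 * k)) := by
    intro t ht
    rw [eval_coeffMap, hθ, kernelOpLM_apply, hQ, coe_aeval_treeCore, kernel_prod_gaussConv_eq, norm_mul,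
      norm_inv_factorial_smul_one, ← genProdOn_univ 𝕜 Z, ← Module.End.mul_apply, ← applyOps_scriptOps]
    refine mul_le_mul_of_nonneg_left ?_ (inv_nonneg.2 (Nat.cast_nonneg _))
    have h := norm_apply_applyOps_genProdOn_le (gaussExpect 𝕜 (scriptCov C cl s t)) Z hκ
      (fun S => norm_gaussExpect_scriptCov_genProd_le C cl q hC f g hκ hf hg hG s hs ht (Z ∘ S.orderEmbOfFin rfl))
      (scriptOps C cl W s) univ
    rwa [Finset.card_fin, totalCost_scriptOps] at h
  rw [h1]
  exact FermionicTree.norm_cubeIntegral_map_mul_le _ _ (fun t ht => FermionicTree.eval_weight_nonneg s ht) h2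

end KernelBound

end Literature.MathematicalPhysics.QuantumLattice
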